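import Literature.Analysis.FluidPDE.CoordDerivatives
import Literature.Analysis.FluidPDE.SverakLandauRegularize
import HarnessLib

/-!
# Šverák's classification of `(−1)`-homogeneous steady Navier–Stokes flows — calculus of `K`

Analysis/FluidPDE support file, fourth of the series `SverakLandau*` proving the named fact
`Literature.Analysis.FluidPDE.Sverak2011_landauClassification` (V. Šverák, J. Math. Sci. 179
(2011) = arXiv:math/0604550, Thm. 1).

For globally smooth `U : ℝ^ι → ℝ^ι`, `P : ℝ^ι → ℝ` this file computes, with the coordinate
partial derivatives `pderiv l = ∂ₗ` of `CoordDerivatives`, the first and the pure second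
partial derivatives of the building blocks of the Bernoulli function of the series,

  `K = |y|² (½|U|² + P₂) − ½F² − F`,  `F = ⟪y, U⟫`,  `P₂ = −½ ∑ⱼ yⱼ ∂ⱼP`

(`P₂` is the `(−2)`-homogeneous representative of the pressure; on the set where the steady
equations and Euler's relations hold it has the same gradient as `P`, next file):
`∂ₗ|y|² = 2yₗ`, `∂ₗ|U|² = 2∑ᵢ Uᵢ∂ₗUᵢ`, `∂ₗF = Uₗ + ∑ᵢ yᵢ∂ₗUᵢ`,
`∂ₗ∂ₗF = 2∂ₗUₗ + ∑ᵢ yᵢ∂ₗ∂ₗUᵢ`, `∂ₗ(∑ⱼ yⱼ∂ⱼP) = ∂ₗP + ∑ⱼ yⱼ∂ₗ∂ⱼP`, and finally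
(`Sverak2011.pderiv_bernoulliK`, `Sverak2011.pderiv_pderiv_bernoulliK`)

  `∂ₗK = yₗ|U|² + |y|² ∑ᵢ Uᵢ∂ₗUᵢ + 2yₗP₂ + |y|²∂ₗP₂ − (F + 1)∂ₗF`,
  `∂ₗ∂ₗK = |U|² + 4yₗ∑ᵢ Uᵢ∂ₗUᵢ + |y|²∑ᵢ (∂ₗUᵢ)² + |y|²∑ᵢ Uᵢ∂ₗ∂ₗUᵢ + 2P₂ + 4yₗ∂ₗP₂ + |y|²∂ₗ∂ₗP₂
            − (∂ₗF)² − (F + 1)∂ₗ∂ₗF`,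

exactly the shapes consumed by the finite-sum lemma `Sverak2011.bernoulliK_algebra`
(`SverakLandauBernoulliAlgebra`).  Pure product-rule bookkeeping (folklore); the functions are
passed as variables with defining equations (no definitions are introduced).

## References

* V. Šverák, *On Landau's solutions of the Navier–Stokes equations*, J. Math. Sci. 179 (2011)
  208–228, arXiv:math/0604550, §4. [`Sverak2011`]
-/

noncomputable section

open Set Filter
open scoped Topology BigOperators ContDiff

namespace Literature.Analysis.FluidPDE

namespace Sverak2011

variable {ι : Type*} [Fintype ι] [DecidableEq ι]

section Blocks

variable {U : EuclideanSpace ℝ ι → EuclideanSpace ℝ ι} {P : EuclideanSpace ℝ ι → ℝ}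

omit [DecidableEq ι] in
/-- Components of a smooth field are smooth. [folklore] -/
theorem contDiff_comp (hU : ContDiff ℝ ∞ U) (i : ι) :
    ContDiff ℝ ∞ fun y : EuclideanSpace ℝ ι => U y i :=
  contDiff_euclidean.1 hU i

omit [DecidableEq ι] in
/-- Components of a smooth field are differentiable. [folklore] -/
theorem differentiable_comp (hU : ContDiff ℝ ∞ U) (i : ι) :
    Differentiable ℝ fun y : EuclideanSpace ℝ ι => U y i :=
  (contDiff_comp hU i).differentiable (by simp)

/-- Partial derivatives of components of a smooth field are smooth. [folklore] -/
theorem contDiff_pderiv_comp (hU : ContDiff ℝ ∞ U) (l i : ι) :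
    ContDiff ℝ ∞ (pderiv l fun y : EuclideanSpace ℝ ι => U y i) :=
  contDiff_pderiv (contDiff_comp hU i) l

/-- Partial derivatives of components of a smooth field are differentiable. [folklore] -/
theorem differentiable_pderiv_comp (hU : ContDiff ℝ ∞ U) (l i : ι) :
    Differentiable ℝ (pderiv l fun y : EuclideanSpace ℝ ι => U y i) :=
  (contDiff_pderiv_comp hU l i).differentiable (by simp)

/-- Second partial derivatives of components of a smooth field are differentiable. [folklore] -/
theorem differentiable_pderiv_pderiv_comp (hU : ContDiff ℝ ∞ U) (k l i : ι) :
    Differentiable ℝ (pderiv k (pderiv l fun y : EuclideanSpace ℝ ι => U y i)) :=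
  (contDiff_pderiv (contDiff_pderiv_comp hU l i) k).differentiable (by simp)

/-- `∂ₗ |y|² = 2 yₗ`. [folklore] -/
theorem pderiv_normSq (l : ι) :
    pderiv l (fun y : EuclideanSpace ℝ ι => ∑ i, y i ^ 2) = fun y => 2 * y l := by
  rw [pderiv_sum (f := fun i y => y i ^ 2) _ (fun i _ => (differentiable_coord i).pow 2)]
  funext y
  have h : ∀ i, pderiv l (fun y : EuclideanSpace ℝ ι => y i ^ 2) y =
      2 * y i * (if i = l then 1 else 0) := fun i => by
    have := congrFun (pderiv_pow (differentiable_coord i) 1 l) y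
    simp only [pow_one, Nat.cast_one] at this
    rw [this, pderiv_coord]
    ring
  simp only [h, mul_ite, mul_one, mul_zero, Finset.sum_ite_eq', Finset.mem_univ, if_true]

omit [DecidableEq ι] in
/-- The function `y ↦ |y|² = ∑ yᵢ²` is differentiable. [folklore] -/
theorem differentiable_normSq :
    Differentiable ℝ fun y : EuclideanSpace ℝ ι => ∑ i, y i ^ 2 :=
  Differentiable.fun_sum fun i _ => (differentiable_coord i).pow 2

/-- `∂ₗ |U|² = 2 ∑ᵢ Uᵢ ∂ₗUᵢ`. [folklore] -/
theorem pderiv_speedSq (hU : ContDiff ℝ ∞ U) (l : ι) :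
    pderiv l (fun y => ∑ i, U y i ^ 2) =
      fun y => 2 * ∑ i, U y i * pderiv l (fun z => U z i) y := by
  rw [pderiv_sum (f := fun i y => U y i ^ 2) _ (fun i _ => (differentiable_comp hU i).pow 2)]
  funext y
  rw [Finset.mul_sum]
  refine Finset.sum_congr rfl fun i _ => ?_
  have := congrFun (pderiv_pow (differentiable_comp hU i) 1 l) y
  simp only [pow_one, Nat.cast_one] at this
  rw [this]
  ring

omit [DecidableEq ι] in
/-- `|U|²` is differentiable. [folklore] -/
theorem differentiable_speedSq (hU : ContDiff ℝ ∞ U) :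
    Differentiable ℝ fun y => ∑ i, U y i ^ 2 :=
  Differentiable.fun_sum fun i _ => (differentiable_comp hU i).pow 2

/-- `∂ₗ ⟪y, U⟫ = Uₗ + ∑ᵢ yᵢ ∂ₗUᵢ` (Šverák's `∂ₗ f` in the bulk variables). [folklore] -/
theorem pderiv_radial (hU : ContDiff ℝ ∞ U) (l : ι) :
    pderiv l (fun y => ∑ i, y i * U y i) =
      fun y => U y l + ∑ i, y i * pderiv l (fun z => U z i) y := by
  rw [pderiv_sum (f := fun i y => y i * U y i) _
    (fun i _ => (differentiable_coord i).mul (differentiable_comp hU i))]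
  funext y
  have h : ∀ i, pderiv l (fun y : EuclideanSpace ℝ ι => y i * U y i) y =
      (if i = l then 1 else 0) * U y i + y i * pderiv l (fun z => U z i) y := fun i => by
    rw [pderiv_mul (differentiable_coord i) (differentiable_comp hU i)]
    beta_reduce
    rw [pderiv_coord]
  simp only [h, Finset.sum_add_distrib, ite_mul, one_mul, zero_mul, Finset.sum_ite_eq',
    Finset.mem_univ, if_true]

omit [DecidableEq ι] in
/-- `⟪y, U⟫` is differentiable. [folklore] -/
theorem differentiable_radial (hU : ContDiff ℝ ∞ U) :
    Differentiable ℝ fun y => ∑ i, y i * U y i :=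
  Differentiable.fun_sum fun i _ => (differentiable_coord i).mul (differentiable_comp hU i)

omit [DecidableEq ι] in
/-- `⟪y, U⟫` is smooth. [folklore] -/
theorem contDiff_radial (hU : ContDiff ℝ ∞ U) :
    ContDiff ℝ ∞ fun y => ∑ i, y i * U y i :=
  ContDiff.sum fun i _ => (contDiff_coord i).mul (contDiff_comp hU i)

/-- `∂ₗ (Uₗ + ∑ᵢ yᵢ ∂ₗUᵢ) = 2∂ₗUₗ + ∑ᵢ yᵢ ∂ₗ∂ₗUᵢ`: the pure second partial of `⟪y, U⟫`. [folklore] -/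
theorem pderiv_pderiv_radial (hU : ContDiff ℝ ∞ U) (l : ι) :
    pderiv l (fun y => U y l + ∑ i, y i * pderiv l (fun z => U z i) y) =
      fun y => 2 * pderiv l (fun z => U z l) y +
        ∑ i, y i * pderiv l (pderiv l fun z => U z i) y := by
  rw [pderiv_add (f := fun y => U y l) (g := fun y => ∑ i, y i * pderiv l (fun z => U z i) y)
      (differentiable_comp hU l) (Differentiable.fun_sum fun i _ =>
        (differentiable_coord i).mul (differentiable_pderiv_comp hU l i)),
    pderiv_sum (f := fun i y => y i * pderiv l (fun z => U z i) y) _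
      (fun i _ => (differentiable_coord i).mul (differentiable_pderiv_comp hU l i))]
  funext y
  have h : ∀ i, pderiv l (fun y : EuclideanSpace ℝ ι => y i * pderiv l (fun z => U z i) y) y =
      (if i = l then 1 else 0) * pderiv l (fun z => U z i) y +
        y i * pderiv l (pderiv l fun z => U z i) y := fun i => by
    rw [pderiv_mul (differentiable_coord i) (differentiable_pderiv_comp hU l i)]
    beta_reduce
    rw [pderiv_coord]
  simp only [h, Finset.sum_add_distrib, ite_mul, one_mul, zero_mul, Finset.sum_ite_eq',
    Finset.mem_univ, if_true]
  ring

/-- `∂ₗ (∑ⱼ yⱼ ∂ⱼP) = ∂ₗP + ∑ⱼ yⱼ ∂ₗ∂ⱼP`. [folklore] -/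
theorem pderiv_eulerP (hP : ContDiff ℝ ∞ P) (l : ι) :
    pderiv l (fun y => ∑ j, y j * pderiv j P y) =
      fun y => pderiv l P y + ∑ j, y j * pderiv l (pderiv j P) y := by
  have hd : ∀ j, Differentiable ℝ (pderiv j P) := fun j =>
    (contDiff_pderiv hP j).differentiable (by simp)
  rw [pderiv_sum (f := fun j y => y j * pderiv j P y) _
    (fun j _ => (differentiable_coord j).mul (hd j))]
  funext y
  have h : ∀ j, pderiv l (fun y : EuclideanSpace ℝ ι => y j * pderiv j P y) y =
      (if j = l then 1 else 0) * pderiv j P y + y j * pderiv l (pderiv j P) y := fun j => by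
    rw [pderiv_mul (differentiable_coord j) (hd j)]
    beta_reduce
    rw [pderiv_coord]
  simp only [h, Finset.sum_add_distrib, ite_mul, one_mul, zero_mul, Finset.sum_ite_eq',
    Finset.mem_univ, if_true]

/-- `∑ⱼ yⱼ ∂ⱼP` is smooth. [folklore] -/
theorem contDiff_eulerP (hP : ContDiff ℝ ∞ P) :
    ContDiff ℝ ∞ fun y => ∑ j, y j * pderiv j P y :=
  ContDiff.sum fun j _ => (contDiff_coord j).mul (contDiff_pderiv hP j)

/-- `∂ₗ (∑ᵢ Uᵢ ∂ₗUᵢ) = ∑ᵢ (∂ₗUᵢ)² + ∑ᵢ Uᵢ ∂ₗ∂ₗUᵢ`. [folklore] -/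
theorem pderiv_sum_mul_pderiv (hU : ContDiff ℝ ∞ U) (l : ι) :
    pderiv l (fun y => ∑ i, U y i * pderiv l (fun z => U z i) y) =
      fun y => ∑ i, pderiv l (fun z => U z i) y ^ 2 +
        ∑ i, U y i * pderiv l (pderiv l fun z => U z i) y := by
  rw [pderiv_sum (f := fun i y => U y i * pderiv l (fun z => U z i) y) _
    (fun i _ => (differentiable_comp hU i).mul (differentiable_pderiv_comp hU l i))]
  funext y
  rw [← Finset.sum_add_distrib]
  refine Finset.sum_congr rfl fun i _ => ?_
  rw [pderiv_mul (differentiable_comp hU i) (differentiable_pderiv_comp hU l i)]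
  ring

end Blocks

/-! ### The Bernoulli function `K` -/

section BernoulliK

variable {U : EuclideanSpace ℝ ι → EuclideanSpace ℝ ι} {P : EuclideanSpace ℝ ι → ℝ}
  {r2 U2 F P₂ K : EuclideanSpace ℝ ι → ℝ}

/-- **First partials of the Bernoulli function.** For smooth `U`, `P` and
`K = |y|²(½|U|² + P₂) − ½F² − F` (`F = ⟪y, U⟫`, `P₂ = −½∑ⱼ yⱼ∂ⱼP`):
`∂ₗK = yₗ|U|² + |y|²∑ᵢ Uᵢ∂ₗUᵢ + 2yₗP₂ + |y|²∂ₗP₂ − (F + 1)∂ₗF`. [folklore] -/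
theorem pderiv_bernoulliK (hU : ContDiff ℝ ∞ U) (hP : ContDiff ℝ ∞ P)
    (hr2 : r2 = fun y => ∑ i, y i ^ 2) (hU2 : U2 = fun y => ∑ i, U y i ^ 2)
    (hF : F = fun y => ∑ i, y i * U y i) (hP₂ : P₂ = fun y => -(2⁻¹ * ∑ j, y j * pderiv j P y))
    (hK : K = fun y => r2 y * (2⁻¹ * U2 y + P₂ y) - 2⁻¹ * F y ^ 2 - F y) (l : ι) :
    pderiv l K = fun y => y l * U2 y + r2 y * ∑ i, U y i * pderiv l (fun z => U z i) y +
      2 * y l * P₂ y + r2 y * pderiv l P₂ y -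
      (F y + 1) * (U y l + ∑ i, y i * pderiv l (fun z => U z i) y) := by
  have hr2d : Differentiable ℝ r2 := hr2 ▸ differentiable_normSq
  have hU2d : Differentiable ℝ U2 := hU2 ▸ differentiable_speedSq hU
  have hFd : Differentiable ℝ F := hF ▸ differentiable_radial hU
  have hP₂d : Differentiable ℝ P₂ := by
    rw [hP₂]; exact ((contDiff_eulerP hP).differentiable (by simp)).const_mul _ |>.neg
  have h1 : Differentiable ℝ fun y => 2⁻¹ * U2 y + P₂ y := (hU2d.const_mul _).add hP₂d
  have h2 : Differentiable ℝ fun y => r2 y * (2⁻¹ * U2 y + P₂ y) := hr2d.mul h1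
  have h3 : Differentiable ℝ fun y => 2⁻¹ * F y ^ 2 := (hFd.pow 2).const_mul _
  rw [hK, pderiv_sub (f := fun y => r2 y * (2⁻¹ * U2 y + P₂ y) - 2⁻¹ * F y ^ 2) (g := F)
      (h2.sub h3) hFd,
    pderiv_sub (f := fun y => r2 y * (2⁻¹ * U2 y + P₂ y)) (g := fun y => 2⁻¹ * F y ^ 2) h2 h3,
    pderiv_mul (f := r2) (g := fun y => 2⁻¹ * U2 y + P₂ y) hr2d h1,
    pderiv_add (f := fun y => 2⁻¹ * U2 y) (g := P₂) (hU2d.const_mul _) hP₂d,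
    pderiv_const_mul (f := U2) hU2d, pderiv_const_mul (f := fun y => F y ^ 2) (hFd.pow 2)]
  funext y
  beta_reduce
  have e1 : pderiv l r2 y = 2 * y l := by rw [hr2, pderiv_normSq]
  have e2 : pderiv l U2 y = 2 * ∑ i, U y i * pderiv l (fun z => U z i) y := by
    rw [hU2, pderiv_speedSq hU]
  have e3 : pderiv l F y = U y l + ∑ i, y i * pderiv l (fun z => U z i) y := by
    rw [hF, pderiv_radial hU]
  have e4 : pderiv l (fun y => F y ^ 2) y = 2 * F y * pderiv l F y := by
    have := congrFun (pderiv_pow hFd 1 l) y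
    simp only [pow_one, Nat.cast_one] at this
    rw [this]; ring
  rw [e1, e2, e4, e3]
  ring

/-- `P₂ = −½ ∑ⱼ yⱼ ∂ⱼP` is smooth. [folklore] -/
theorem contDiff_P₂ (hP : ContDiff ℝ ∞ P) (hP₂ : P₂ = fun y => -(2⁻¹ * ∑ j, y j * pderiv j P y)) :
    ContDiff ℝ ∞ P₂ := by
  rw [hP₂]; exact (contDiff_const.mul (contDiff_eulerP hP)).neg

/-- The Bernoulli function `K` is smooth. [folklore] -/
theorem contDiff_bernoulliK (hU : ContDiff ℝ ∞ U) (hP : ContDiff ℝ ∞ P)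
    (hr2 : r2 = fun y => ∑ i, y i ^ 2) (hU2 : U2 = fun y => ∑ i, U y i ^ 2)
    (hF : F = fun y => ∑ i, y i * U y i) (hP₂ : P₂ = fun y => -(2⁻¹ * ∑ j, y j * pderiv j P y))
    (hK : K = fun y => r2 y * (2⁻¹ * U2 y + P₂ y) - 2⁻¹ * F y ^ 2 - F y) :
    ContDiff ℝ ∞ K := by
  have hr2c : ContDiff ℝ ∞ r2 := hr2 ▸ ContDiff.sum fun i _ => (contDiff_coord i).pow 2
  have hU2c : ContDiff ℝ ∞ U2 := hU2 ▸ ContDiff.sum fun i _ => (contDiff_comp hU i).pow 2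
  have hFc : ContDiff ℝ ∞ F := hF ▸ contDiff_radial hU
  rw [hK]
  exact ((hr2c.mul ((contDiff_const.mul hU2c).add (contDiff_P₂ hP hP₂))).sub
    (contDiff_const.mul (hFc.pow 2))).sub hFc

/-- **Pure second partials of the Bernoulli function.** With the notation of
`pderiv_bernoulliK`: `∂ₗ∂ₗK = |U|² + 4yₗ∑ᵢ Uᵢ∂ₗUᵢ + |y|²∑ᵢ (∂ₗUᵢ)² + |y|²∑ᵢ Uᵢ∂ₗ∂ₗUᵢ + 2P₂
+ 4yₗ∂ₗP₂ + |y|²∂ₗ∂ₗP₂ − (∂ₗF)² − (F + 1)∂ₗ∂ₗF`. [folklore] -/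
theorem pderiv_pderiv_bernoulliK (hU : ContDiff ℝ ∞ U) (hP : ContDiff ℝ ∞ P)
    (hr2 : r2 = fun y => ∑ i, y i ^ 2) (hU2 : U2 = fun y => ∑ i, U y i ^ 2)
    (hF : F = fun y => ∑ i, y i * U y i) (hP₂ : P₂ = fun y => -(2⁻¹ * ∑ j, y j * pderiv j P y))
    (hK : K = fun y => r2 y * (2⁻¹ * U2 y + P₂ y) - 2⁻¹ * F y ^ 2 - F y) (l : ι) :
    pderiv l (pderiv l K) = fun y => U2 y + 4 * y l * ∑ i, U y i * pderiv l (fun z => U z i) y +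
      r2 y * ∑ i, pderiv l (fun z => U z i) y ^ 2 +
      r2 y * ∑ i, U y i * pderiv l (pderiv l fun z => U z i) y +
      2 * P₂ y + 4 * y l * pderiv l P₂ y + r2 y * pderiv l (pderiv l P₂) y -
      (U y l + ∑ i, y i * pderiv l (fun z => U z i) y) ^ 2 -
      (F y + 1) * (2 * pderiv l (fun z => U z l) y +
        ∑ i, y i * pderiv l (pderiv l fun z => U z i) y) := by
  have hr2d : Differentiable ℝ r2 := hr2 ▸ differentiable_normSq
  have hU2d : Differentiable ℝ U2 := hU2 ▸ differentiable_speedSq hU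
  have hFd : Differentiable ℝ F := hF ▸ differentiable_radial hU
  have hP₂c : ContDiff ℝ ∞ P₂ := contDiff_P₂ hP hP₂
  have hP₂d : Differentiable ℝ P₂ := hP₂c.differentiable (by simp)
  have hdP₂d : Differentiable ℝ (pderiv l P₂) := (contDiff_pderiv hP₂c l).differentiable (by simp)
  have hG : Differentiable ℝ fun y => ∑ i, U y i * pderiv l (fun z => U z i) y :=
    Differentiable.fun_sum fun i _ => (differentiable_comp hU i).mul (differentiable_pderiv_comp hU l i)
  have hF₁ : Differentiable ℝ fun y => U y l + ∑ i, y i * pderiv l (fun z => U z i) y :=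
    (differentiable_comp hU l).add (Differentiable.fun_sum fun i _ =>
      (differentiable_coord i).mul (differentiable_pderiv_comp hU l i))
  have hA : Differentiable ℝ fun y : EuclideanSpace ℝ ι => y l * U2 y :=
    (differentiable_coord l).mul hU2d
  have hB : Differentiable ℝ fun y => r2 y * ∑ i, U y i * pderiv l (fun z => U z i) y :=
    hr2d.mul hG
  have hC : Differentiable ℝ fun y : EuclideanSpace ℝ ι => 2 * y l * P₂ y :=
    (((differentiable_coord l).const_mul 2)).mul hP₂d
  have hD : Differentiable ℝ fun y => r2 y * pderiv l P₂ y := hr2d.mul hdP₂d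
  have hE : Differentiable ℝ fun y => (F y + 1) * (U y l + ∑ i, y i * pderiv l (fun z => U z i) y) :=
    (hFd.add_const 1).mul hF₁
  rw [pderiv_bernoulliK hU hP hr2 hU2 hF hP₂ hK l,
    pderiv_sub (f := fun y => y l * U2 y + r2 y * ∑ i, U y i * pderiv l (fun z => U z i) y +
        2 * y l * P₂ y + r2 y * pderiv l P₂ y)
      (g := fun y => (F y + 1) * (U y l + ∑ i, y i * pderiv l (fun z => U z i) y))
      (((hA.add hB).add hC).add hD) hE,
    pderiv_add (f := fun y => y l * U2 y + r2 y * ∑ i, U y i * pderiv l (fun z => U z i) y +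
        2 * y l * P₂ y) (g := fun y => r2 y * pderiv l P₂ y) ((hA.add hB).add hC) hD,
    pderiv_add (f := fun y => y l * U2 y + r2 y * ∑ i, U y i * pderiv l (fun z => U z i) y)
      (g := fun y => 2 * y l * P₂ y) (hA.add hB) hC,
    pderiv_add (f := fun y => y l * U2 y)
      (g := fun y => r2 y * ∑ i, U y i * pderiv l (fun z => U z i) y) hA hB,
    pderiv_mul (f := fun y => y l) (g := U2) (differentiable_coord l) hU2d,
    pderiv_mul (f := r2) (g := fun y => ∑ i, U y i * pderiv l (fun z => U z i) y) hr2d hG,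
    pderiv_mul (f := fun y => 2 * y l) (g := P₂) ((differentiable_coord l).const_mul 2) hP₂d,
    pderiv_mul (f := r2) (g := pderiv l P₂) hr2d hdP₂d,
    pderiv_mul (f := fun y => F y + 1)
      (g := fun y => U y l + ∑ i, y i * pderiv l (fun z => U z i) y) (hFd.add_const 1) hF₁,
    pderiv_const_mul (f := fun y => y l) (differentiable_coord l), pderiv_sum_mul_pderiv hU l,
    pderiv_pderiv_radial hU l]
  funext y
  beta_reduce
  have e1 : pderiv l r2 y = 2 * y l := by rw [hr2, pderiv_normSq]
  have e2 : pderiv l U2 y = 2 * ∑ i, U y i * pderiv l (fun z => U z i) y := by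
    rw [hU2, pderiv_speedSq hU]
  have e3 : pderiv l (fun y => F y + 1) y = U y l + ∑ i, y i * pderiv l (fun z => U z i) y := by
    rw [pderiv_add (f := F) (g := fun _ => (1 : ℝ)) hFd (differentiable_const _), pderiv_const, hF,
      pderiv_radial hU]
    simp
  rw [e1, e2, e3, pderiv_coord]
  simp only [if_true]
  ring

end BernoulliK

end Sverak2011

end Literature.Analysis.FluidPDE
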